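import Summits.QuantumFields.BalabanUV.T4Continuum.Support.RegionStarTrace
import Summits.QuantumFields.BalabanUV.T4Continuum.Support.DirichletStarSlabLayer

/-!
# T⁴ programme, spine node NE2 (U1a), sub-row Δ1 «NE2⁰-Dirichlet» — THE RENORMALISED INJECTED LAW W3̃ REDUCED TO KING's COMPRESSED
# INJECTED LAW W3: `J̃ = J·N`, `G′J̃ − J̃G = (G′J − JG)·N + J·[G, N]`, and `‖[G_k, N_k]‖ ≤ 2(√L − 1)·√((2γ⁻¹ + CgI)·γ⁻¹/n_k)`
# from the trace inequality — so W3̃ at rate `θ` ⟺ W3 at rate `θ` for every `θ ∈ [(√L)⁻¹, 1)`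

NE2 formalisation swarm `b2b-balaban-t4-ne2-formalise-*`, LEAF PROVER 06 (gen 6), supplier item «Δ1-VEC-W3̃-TRACE» (journal
2026-08-20 l.20563), file 2 of 3, on file 1 `Support/RegionStarTrace` (`opNorm_inv_mul_defP_le`).  Objects (all in the tree): the
star carriers `pidx L M (starP L M S) k`, the faithful `U = 1` region operator `D_k = regionDeltaA (lev L k) M a a′ S` (Hermitian,
`DirichletStarVectorTower`), King's COMPRESSED planting `J_k = JpR L M (starP L M S) k` (`DirichletSubregionTowerOf`, p224434) and the
owner's RENORMALISED planting `J̃_k = JnR L M (starP L M S) k` (`DirichletSubregionRenormTower`, p228571; isometry).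

 * §1 the RENORMALISATION MATRIX `Nmat k = diagonal(√(L^d / nch))` and its inverse `NmatInv k = diagonal(√(nch / L^d))`:
   `JnR = JpR·Nmat` (**`JnR_eq_JpR_mul_Nmat`**), `Nmat = 1 + (√L − 1)•P_def` (`nch = L^d` / `L^{d−1}` on regular / deficient star bonds,
   `DirichletStarSlabLayer.nch_eq`), `Nmat·NmatInv = 1`, `‖Nmat‖ ≤ √L`, `‖NmatInv‖ ≤ 1`;
 * §2 the ALGEBRA **`renorm_defect_eq`**: `G′·J̃ − J̃·G = (G′·J − J·G)·Nmat + J·(G·Nmat − Nmat·G)` and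
   `G·Nmat − Nmat·G = (√L − 1)•(G·P_def − P_def·G)`, `‖G·P_def − P_def·G‖ ≤ 2‖G·P_def‖` for Hermitian `G`;
 * §3 THE COMMUTATOR BOUND per level **`opNorm_comm_le`**: W1 (`Coercive D_k γ`) + interior W2 at level `k` ⟹
   `‖G_k·Nmat_k − Nmat_k·G_k‖ ≤ 2(√L − 1)·√((2γ⁻¹ + CgI)·γ⁻¹ / n_k)`, and the crude `≤ 2(√L − 1)·γ⁻¹` from W1 alone;
 * §4 THE TWO-SIDED REDUCTION per level: **`renorm_le_of_compressed`** `‖G′J̃ − J̃G‖ ≤ √L·‖G′J − JG‖ + ‖[G,N]‖` and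
   **`compressed_le_of_renorm`** `‖G′J − JG‖ ≤ ‖G′J̃ − J̃G‖ + ‖[G,N]‖`;
 * file 3 `Support/DirichletStarRenormBoxTower` runs §3–§4 along the tower: W3̃ at rate `θ` ⟺ W3 at rate `θ` for every
   `θ ∈ [(√L)⁻¹, 1)` (leaf-02-g7's `DirichletStarRenormSlabNoGo`: no better rate is available to W3̃ off `⊤`), and the product-region END.

HONEST FRAMING (T4-DAG p. 1).  [folklore] finite-dimensional linear algebra + file 1's lattice trace inequality on the cell's typed
`U = 1` objects (one region, one averaging scale, finite torus, operator norm); W1 and interior W2 enter as DISPLAYED hypotheses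
(theorems on product regions elsewhere: owner O14-a + gen 5's tent comparison; leaf-07-g7's `interiorW2_of_slice`); W3 for King's
compressed planting is NOT proved here or anywhere — it stays the one displayed injected law; Δ1 NOT closed; NE2 (U1a) NOT proved;
spine PROVED 0/9 unchanged; NOT [B9] (3.16)/(3.23)–(3.27) as printed; NOT infinite volume / mass gap / Clay.  HONEST DEPENDENCY:
continuum YM on T⁴ ⇐ BetaPertH ∧ nine spine estimates (0/9 proved); BetaPertH ⇐ (D1) ∧ (D4) ∧ CAP+tail; G-an2-4 gates asym, D1 and
NE2/3/4.  No `sorry`.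
-/

noncomputable section

open scoped BigOperators ComplexConjugate Matrix Matrix.Norms.L2Operator
open Finset

namespace Summit.QuantumFields.BalabanUV.T4Continuum.DirichletStarRenormReduction

open Literature.MathematicalPhysics.QuantumFieldTheory.Balaban1983to89.B5Prop11Plancherel (Tor fine unitVec opNorm_le_of_sq_le)
open Literature.MathematicalPhysics.QuantumFieldTheory.Balaban1983to89.B5Prop11Lower (nsq nsq_nonneg)
open Literature.MathematicalPhysics.QuantumFieldTheory.Balaban1983to89.B5G183RateUnitTower (lev)
open Summit.QuantumFields.BalabanUV.T4Continuum
open Summit.QuantumFields.BalabanUV.T4Continuum.BalabanAveragedTowerUnit (idx cast_lev')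
open Summit.QuantumFields.BalabanUV.T4Continuum.BlockPairingGeometry (parT JK_apply)
open Summit.QuantumFields.BalabanUV.T4Continuum.KingPairingPlantedLaw (JpcT_eq_JK)
open Summit.QuantumFields.BalabanUV.T4Continuum.SubtypeCompression (Coercive isUnit_det_of_coercive opNorm_inv_le_of_coercive)
open Summit.QuantumFields.BalabanUV.T4Continuum.BackgroundResolventLaw (l2_opNorm_one_le)
open Summit.QuantumFields.BalabanUV.T4Continuum.DirichletSubregionTowerOf (pidx JpR opNorm_JpR_le)
open Summit.QuantumFields.BalabanUV.T4Continuum.DirichletSubregionRenormTower (nch JnR)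
open Summit.QuantumFields.BalabanUV.T4Continuum.RegionGaugeFixedVector (starReg regionDeltaA)
open Summit.QuantumFields.BalabanUV.T4Continuum.DirichletStarVectorTower (starP regionDeltaA_isHermitian)
open Summit.QuantumFields.BalabanUV.T4Continuum.DirichletStarRenormTower (igrad nch_star_pos)
open Summit.QuantumFields.BalabanUV.T4Continuum.DirichletStarSlabLayer (nch_eq)
open Summit.QuantumFields.BalabanUV.T4Continuum.RegionStarTrace (defP defP_conjTranspose opNorm_defP_le opNorm_inv_mul_defP_le)
open Summit.QuantumFields.BalabanUV.Beta.GAN24.DirichletBoxTrace (blockReg)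

variable {d : ℕ} (L : ℕ) [NeZero L] (M : Fin d → ℕ) [hM : ∀ μ, NeZero (M μ)] (S : Tor M → Prop) [DecidablePred S]

/-! ## §1 The renormalisation matrix -/

/-- the renormalisation weight of a star index: `√(L^d / nch)`. [folklore] -/
def nwt (k : ℕ) (i : pidx L M (starP L M S) k) : ℝ := Real.sqrt ((L : ℝ) ^ d / nch L M (starP L M S) k i.1)

/-- **THE RENORMALISATION MATRIX** `N_k = diagonal(√(L^d / nch))`. [folklore] -/
def Nmat (k : ℕ) : Matrix (pidx L M (starP L M S) k) (pidx L M (starP L M S) k) ℂ :=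
  Matrix.diagonal fun i => ((nwt L M S k i : ℝ) : ℂ)

/-- its inverse `diagonal(√(nch / L^d))`. [folklore] -/
def NmatInv (k : ℕ) : Matrix (pidx L M (starP L M S) k) (pidx L M (starP L M S) k) ℂ :=
  Matrix.diagonal fun i => (((nwt L M S k i)⁻¹ : ℝ) : ℂ)

omit [NeZero L] in
/-- `0 ≤ √L − 1` (`1 ≤ L`). [folklore] -/
theorem sqrt_sub_one_nonneg (hL : 1 ≤ L) : 0 ≤ Real.sqrt L - 1 := by
  rw [sub_nonneg, show (1 : ℝ) = Real.sqrt 1 from Real.sqrt_one.symm]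
  exact Real.sqrt_le_sqrt (by exact_mod_cast hL)

/-- **THE WEIGHTS**: `1` on regular star bonds (base point in `Ω_k`), `√L` on deficient ones. [folklore] -/
theorem nwt_eq (k : ℕ) (i : pidx L M (starP L M S) k) :
    nwt L M S k i = if blockReg (lev L k) M S i.1.1 then 1 else Real.sqrt L := by
  have hL : (0 : ℝ) < L := by exact_mod_cast Nat.pos_of_ne_zero (NeZero.ne L)
  have hd : 0 < d := Fin.pos i.1.2
  unfold nwt
  rw [nch_eq M L S k i]
  split_ifs with h
  · rw [div_self (pow_pos hL d).ne', Real.sqrt_one]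
  · congr 1
    rw [div_eq_iff (pow_pos hL _).ne', ← pow_succ', Nat.sub_add_cancel hd]

/-- `1 ≤ nwt ≤ √L` (`1 ≤ L`). [folklore] -/
theorem nwt_mem (hL : 1 ≤ L) (k : ℕ) (i : pidx L M (starP L M S) k) : 1 ≤ nwt L M S k i ∧ nwt L M S k i ≤ Real.sqrt L := by
  have h1 : (1 : ℝ) ≤ Real.sqrt L := by
    rw [show (1 : ℝ) = Real.sqrt 1 from Real.sqrt_one.symm]
    exact Real.sqrt_le_sqrt (by exact_mod_cast hL)
  rw [nwt_eq]
  split_ifs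
  · exact ⟨le_rfl, h1⟩
  · exact ⟨h1, le_rfl⟩

/-- `0 < nwt`. [folklore] -/
theorem nwt_pos (hL : 1 ≤ L) (k : ℕ) (i : pidx L M (starP L M S) k) : 0 < nwt L M S k i :=
  lt_of_lt_of_le one_pos (nwt_mem L M S hL k i).1

/-- the real identity behind `J̃ = J·N`: `√(L^d)·(L^d)⁻¹·√(L^d / m) = (√m)⁻¹` (`m > 0`). [folklore] -/
theorem weight_identity {m : ℝ} (hm : 0 < m) :
    Real.sqrt ((L : ℝ) ^ d) * ((L : ℝ) ^ d)⁻¹ * Real.sqrt ((L : ℝ) ^ d / m) = (Real.sqrt m)⁻¹ := by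
  have hLd : (0 : ℝ) < (L : ℝ) ^ d := pow_pos (by exact_mod_cast Nat.pos_of_ne_zero (NeZero.ne L)) d
  have hs : Real.sqrt ((L : ℝ) ^ d) ≠ 0 := (Real.sqrt_pos.mpr hLd).ne'
  have hsm : Real.sqrt m ≠ 0 := (Real.sqrt_pos.mpr hm).ne'
  rw [Real.sqrt_div hLd.le]
  field_simp
  rw [Real.sq_sqrt hLd.le]

/-- **`J̃ = J·N`**: the renormalised planting is King's compressed planting followed by the diagonal renormalisation. [folklore] -/
theorem JnR_eq_JpR_mul_Nmat (k : ℕ) : JnR L M (starP L M S) k = JpR L M (starP L M S) k * Nmat L M S k := by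
  ext y i
  rw [Nmat, Matrix.mul_diagonal, JpR, Matrix.toBlock_apply, JpcT_eq_JK, JK_apply, JnR]
  have hn : (0 : ℝ) < nch L M (starP L M S) k i.1 := by exact_mod_cast nch_star_pos L M S k i
  by_cases h : parT (lev L k) L M y.1 = i.1
  · rw [if_pos h, if_pos h, mul_one, nwt, ← weight_identity L hn]
    push_cast
    ring
  · rw [if_neg h, if_neg h, mul_zero, mul_zero, zero_mul]

/-- **`N = 1 + (√L − 1)•P_def`**. [folklore] -/
theorem Nmat_eq (k : ℕ) :
    Nmat L M S k = 1 + (((Real.sqrt L - 1 : ℝ)) : ℂ) • defP (lev L k) M S := by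
  ext i j
  rw [Nmat, defP, Matrix.add_apply, Matrix.smul_apply, Matrix.one_apply, smul_eq_mul]
  by_cases hij : i = j
  · subst hij
    rw [Matrix.diagonal_apply_eq, Matrix.diagonal_apply_eq, if_pos rfl, nwt_eq]
    by_cases h : blockReg (lev L k) M S i.1.1
    · rw [if_pos h, if_pos h, mul_zero, add_zero, Complex.ofReal_one]
    · rw [if_neg h, if_neg h, mul_one]; push_cast; ring
  · rw [Matrix.diagonal_apply_ne _ hij, Matrix.diagonal_apply_ne _ hij, if_neg hij, mul_zero, add_zero]

/-- K-TEST at `S = ⊤` (no deficient bonds): `N = 1`, so `J̃ = J` (cf. leaf-07-g7's `RegionInteriorW2Top.JnR_top_eq`). [folklore] -/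
theorem Nmat_top (k : ℕ) : Nmat L M (fun _ : Tor M => True) k = 1 := by
  unfold Nmat
  rw [← Matrix.diagonal_one]
  congr 1; funext i
  rw [nwt_eq, if_pos (show blockReg (lev L k) M (fun _ : Tor M => True) i.1.1 from trivial), Complex.ofReal_one]

/-- `N·N⁻¹ = 1`. [folklore] -/
theorem Nmat_mul_NmatInv (hL : 1 ≤ L) (k : ℕ) : Nmat L M S k * NmatInv L M S k = 1 := by
  unfold Nmat NmatInv
  rw [Matrix.diagonal_mul_diagonal, ← Matrix.diagonal_one]
  congr 1; funext i
  rw [← Complex.ofReal_mul, mul_inv_cancel₀ (nwt_pos L M S hL k i).ne', Complex.ofReal_one]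

/-- a diagonal real matrix with entries bounded by `C ≥ 0` has operator norm `≤ C`. [folklore] -/
theorem opNorm_diagonal_le {ι : Type*} [Fintype ι] [DecidableEq ι] (w : ι → ℝ) {C : ℝ} (hC : 0 ≤ C) (hw : ∀ i, |w i| ≤ C) :
    ‖Matrix.diagonal (fun i => ((w i : ℝ) : ℂ))‖ ≤ C := by
  refine opNorm_le_of_sq_le _ hC fun x => ?_
  rw [mul_sum]
  refine sum_le_sum fun i _ => ?_
  have e : ∑ j, Matrix.diagonal (fun i => ((w i : ℝ) : ℂ)) i j * x j = ((w i : ℝ) : ℂ) * x i := by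
    rw [Finset.sum_eq_single i]
    · rw [Matrix.diagonal_apply_eq]
    · intro j _ hj; rw [Matrix.diagonal_apply_ne _ (Ne.symm hj), zero_mul]
    · intro h; exact absurd (mem_univ i) h
  rw [e, norm_mul, mul_pow, Complex.norm_real, Real.norm_eq_abs]
  have h2 : |w i| ^ 2 ≤ C ^ 2 := pow_le_pow_left₀ (abs_nonneg _) (hw i) 2
  exact mul_le_mul_of_nonneg_right h2 (by positivity)

/-- `‖N‖ ≤ √L`. [folklore] -/
theorem opNorm_Nmat_le (hL : 1 ≤ L) (k : ℕ) : ‖Nmat L M S k‖ ≤ Real.sqrt L :=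
  opNorm_diagonal_le _ (Real.sqrt_nonneg _) fun i => by
    rw [abs_of_pos (nwt_pos L M S hL k i)]; exact (nwt_mem L M S hL k i).2

/-- `‖N⁻¹‖ ≤ 1`. [folklore] -/
theorem opNorm_NmatInv_le (hL : 1 ≤ L) (k : ℕ) : ‖NmatInv L M S k‖ ≤ 1 :=
  opNorm_diagonal_le _ zero_le_one fun i => by
    rw [abs_of_pos (inv_pos.mpr (nwt_pos L M S hL k i))]
    exact inv_le_one_of_one_le₀ (nwt_mem L M S hL k i).1

/-! ## §2 The algebra of the reduction -/

section Algebra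

variable (k : ℕ) (G' : Matrix (pidx L M (starP L M S) (k + 1)) (pidx L M (starP L M S) (k + 1)) ℂ)
  (G : Matrix (pidx L M (starP L M S) k) (pidx L M (starP L M S) k) ℂ)

/-- **THE DECOMPOSITION**: `G′·J̃ − J̃·G = (G′·J − J·G)·N + J·(G·N − N·G)`. [folklore] -/
theorem renorm_defect_eq :
    G' * JnR L M (starP L M S) k - JnR L M (starP L M S) k * G
      = (G' * JpR L M (starP L M S) k - JpR L M (starP L M S) k * G) * Nmat L M S k
        + JpR L M (starP L M S) k * (G * Nmat L M S k - Nmat L M S k * G) := by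
  rw [JnR_eq_JpR_mul_Nmat, Matrix.sub_mul, Matrix.mul_sub, Matrix.mul_assoc, Matrix.mul_assoc, Matrix.mul_assoc]
  abel

/-- the converse reading: `G′·J − J·G = ((G′·J̃ − J̃·G) − J·(G·N − N·G))·N⁻¹`. [folklore] -/
theorem compressed_defect_eq (hL : 1 ≤ L) :
    G' * JpR L M (starP L M S) k - JpR L M (starP L M S) k * G
      = ((G' * JnR L M (starP L M S) k - JnR L M (starP L M S) k * G)
          - JpR L M (starP L M S) k * (G * Nmat L M S k - Nmat L M S k * G)) * NmatInv L M S k := by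
  rw [renorm_defect_eq, add_sub_cancel_right, Matrix.mul_assoc, Nmat_mul_NmatInv L M S hL, Matrix.mul_one]

/-- **THE COMMUTATOR IS A BOUNDARY TERM**: `G·N − N·G = (√L − 1)•(G·P_def − P_def·G)`. [folklore] -/
theorem comm_eq :
    G * Nmat L M S k - Nmat L M S k * G
      = (((Real.sqrt L - 1 : ℝ)) : ℂ) • (G * defP (lev L k) M S - defP (lev L k) M S * G) := by
  rw [Nmat_eq, Matrix.mul_add, Matrix.add_mul, Matrix.mul_one, Matrix.one_mul, Matrix.mul_smul, Matrix.smul_mul, smul_sub]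
  abel

/-- for Hermitian `G`: `‖G·P_def − P_def·G‖ ≤ 2‖G·P_def‖`. [folklore] -/
theorem opNorm_commP_le (hG : G.IsHermitian) :
    ‖G * defP (lev L k) M S - defP (lev L k) M S * G‖ ≤ 2 * ‖G * defP (lev L k) M S‖ := by
  have h1 : ‖defP (lev L k) M S * G‖ = ‖G * defP (lev L k) M S‖ := by
    rw [← Matrix.l2_opNorm_conjTranspose (defP (lev L k) M S * G), Matrix.conjTranspose_mul, defP_conjTranspose, hG.eq]
  calc ‖G * defP (lev L k) M S - defP (lev L k) M S * G‖ ≤ ‖G * defP (lev L k) M S‖ + ‖defP (lev L k) M S * G‖ := norm_sub_le _ _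
    _ = 2 * ‖G * defP (lev L k) M S‖ := by rw [h1]; ring

end Algebra

/-! ## §3 The commutator bound per level -/

section Level

variable (a a' : ℝ)

/-- the inverse of the faithful region operator is Hermitian. [folklore] -/
theorem inv_regionDeltaA_isHermitian (n : ℕ) [NeZero n] : ((regionDeltaA n M a a' S)⁻¹).IsHermitian :=
  (regionDeltaA_isHermitian n M a a' S).inv

/-- **THE COMMUTATOR BOUND FROM THE TRACE INEQUALITY**: W1 (`Coercive D_k γ`) + interior W2 at level `k` ⟹
`‖G_k·N_k − N_k·G_k‖ ≤ 2(√L − 1)·√((2γ⁻¹ + CgI)·γ⁻¹ / n_k)`. [folklore] -/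
theorem opNorm_comm_le (hL : 1 ≤ L) (k : ℕ) {γ CgI : ℝ} (hγ : 0 < γ) (hCgI : 0 ≤ CgI)
    (hcoer : Coercive (regionDeltaA (lev L k) M a a' S) γ)
    (hI : ∀ w : pidx L M (starP L M S) k → ℂ,
      ∑ μ, nsq (igrad M S (lev L k) μ w) ≤ CgI * (star w ⬝ᵥ (regionDeltaA (lev L k) M a a' S *ᵥ w)).re) :
    ‖(regionDeltaA (lev L k) M a a' S)⁻¹ * Nmat L M S k - Nmat L M S k * (regionDeltaA (lev L k) M a a' S)⁻¹‖
      ≤ 2 * (Real.sqrt L - 1) * Real.sqrt ((2 * γ⁻¹ + CgI) * γ⁻¹ / (lev L k : ℕ)) := by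
  have hs : 0 ≤ Real.sqrt L - 1 := sqrt_sub_one_nonneg L hL
  rw [comm_eq, norm_smul, Complex.norm_real, Real.norm_of_nonneg hs]
  have h1 := opNorm_commP_le L M S k _ (inv_regionDeltaA_isHermitian M S a a' (lev L k))
  have h2 := opNorm_inv_mul_defP_le (lev L k) M S (regionDeltaA (lev L k) M a a' S) hγ hCgI hcoer hI
  calc (Real.sqrt L - 1) * ‖(regionDeltaA (lev L k) M a a' S)⁻¹ * defP (lev L k) M S - defP (lev L k) M S * (regionDeltaA (lev L k) M a a' S)⁻¹‖
      ≤ (Real.sqrt L - 1) * (2 * Real.sqrt ((2 * γ⁻¹ + CgI) * γ⁻¹ / (lev L k : ℕ))) :=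
        mul_le_mul_of_nonneg_left (h1.trans (by linarith [h2])) hs
    _ = 2 * (Real.sqrt L - 1) * Real.sqrt ((2 * γ⁻¹ + CgI) * γ⁻¹ / (lev L k : ℕ)) := by ring

/-- the CRUDE commutator bound from W1 alone: `‖G_k·N_k − N_k·G_k‖ ≤ 2(√L − 1)·γ⁻¹` (used at level `0`). [folklore] -/
theorem opNorm_comm_le_crude (hL : 1 ≤ L) (k : ℕ) {γ : ℝ} (hγ : 0 < γ) (hcoer : Coercive (regionDeltaA (lev L k) M a a' S) γ) :
    ‖(regionDeltaA (lev L k) M a a' S)⁻¹ * Nmat L M S k - Nmat L M S k * (regionDeltaA (lev L k) M a a' S)⁻¹‖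
      ≤ 2 * (Real.sqrt L - 1) * γ⁻¹ := by
  have hs : 0 ≤ Real.sqrt L - 1 := sqrt_sub_one_nonneg L hL
  rw [comm_eq, norm_smul, Complex.norm_real, Real.norm_of_nonneg hs]
  have h1 := opNorm_commP_le L M S k _ (inv_regionDeltaA_isHermitian M S a a' (lev L k))
  have h2 : ‖(regionDeltaA (lev L k) M a a' S)⁻¹ * defP (lev L k) M S‖ ≤ γ⁻¹ :=
    (Matrix.l2_opNorm_mul _ _).trans (by
      have h3 := opNorm_inv_le_of_coercive hγ hcoer
      have h4 := opNorm_defP_le (lev L k) M S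
      nlinarith [norm_nonneg ((regionDeltaA (lev L k) M a a' S)⁻¹), norm_nonneg (defP (lev L k) M S)])
  calc (Real.sqrt L - 1) * ‖(regionDeltaA (lev L k) M a a' S)⁻¹ * defP (lev L k) M S - defP (lev L k) M S * (regionDeltaA (lev L k) M a a' S)⁻¹‖
      ≤ (Real.sqrt L - 1) * (2 * γ⁻¹) := mul_le_mul_of_nonneg_left (h1.trans (by linarith [h2])) hs
    _ = 2 * (Real.sqrt L - 1) * γ⁻¹ := by ring

/-! ## §4 The two-sided reduction per level -/

/-- **W3̃ FROM W3 (one level)**: `‖G′·J̃ − J̃·G‖ ≤ √L·‖G′·J − J·G‖ + ‖G·N − N·G‖`. [folklore] -/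
theorem renorm_le_of_compressed (hL : 1 ≤ L) (k : ℕ)
    (G' : Matrix (pidx L M (starP L M S) (k + 1)) (pidx L M (starP L M S) (k + 1)) ℂ)
    (G : Matrix (pidx L M (starP L M S) k) (pidx L M (starP L M S) k) ℂ) :
    ‖G' * JnR L M (starP L M S) k - JnR L M (starP L M S) k * G‖
      ≤ Real.sqrt L * ‖G' * JpR L M (starP L M S) k - JpR L M (starP L M S) k * G‖ + ‖G * Nmat L M S k - Nmat L M S k * G‖ := by
  rw [renorm_defect_eq]
  have hJ := opNorm_JpR_le L M (starP L M S) k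
  have hN := opNorm_Nmat_le L M S hL k
  calc ‖(G' * JpR L M (starP L M S) k - JpR L M (starP L M S) k * G) * Nmat L M S k
          + JpR L M (starP L M S) k * (G * Nmat L M S k - Nmat L M S k * G)‖
      ≤ ‖(G' * JpR L M (starP L M S) k - JpR L M (starP L M S) k * G) * Nmat L M S k‖
          + ‖JpR L M (starP L M S) k * (G * Nmat L M S k - Nmat L M S k * G)‖ := norm_add_le _ _
    _ ≤ ‖G' * JpR L M (starP L M S) k - JpR L M (starP L M S) k * G‖ * ‖Nmat L M S k‖
          + ‖JpR L M (starP L M S) k‖ * ‖G * Nmat L M S k - Nmat L M S k * G‖ :=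
        add_le_add (Matrix.l2_opNorm_mul _ _) (Matrix.l2_opNorm_mul _ _)
    _ ≤ Real.sqrt L * ‖G' * JpR L M (starP L M S) k - JpR L M (starP L M S) k * G‖ + ‖G * Nmat L M S k - Nmat L M S k * G‖ := by
        nlinarith [norm_nonneg (G' * JpR L M (starP L M S) k - JpR L M (starP L M S) k * G),
          norm_nonneg (G * Nmat L M S k - Nmat L M S k * G), norm_nonneg (Nmat L M S k), norm_nonneg (JpR L M (starP L M S) k)]

/-- **W3 FROM W3̃ (one level)**: `‖G′·J − J·G‖ ≤ ‖G′·J̃ − J̃·G‖ + ‖G·N − N·G‖`. [folklore] -/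
theorem compressed_le_of_renorm (hL : 1 ≤ L) (k : ℕ)
    (G' : Matrix (pidx L M (starP L M S) (k + 1)) (pidx L M (starP L M S) (k + 1)) ℂ)
    (G : Matrix (pidx L M (starP L M S) k) (pidx L M (starP L M S) k) ℂ) :
    ‖G' * JpR L M (starP L M S) k - JpR L M (starP L M S) k * G‖
      ≤ ‖G' * JnR L M (starP L M S) k - JnR L M (starP L M S) k * G‖ + ‖G * Nmat L M S k - Nmat L M S k * G‖ := by
  have hJ := opNorm_JpR_le L M (starP L M S) k
  have hNi := opNorm_NmatInv_le L M S hL k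
  have h1 : ‖G' * JpR L M (starP L M S) k - JpR L M (starP L M S) k * G‖
      ≤ ‖(G' * JnR L M (starP L M S) k - JnR L M (starP L M S) k * G)
          - JpR L M (starP L M S) k * (G * Nmat L M S k - Nmat L M S k * G)‖ * ‖NmatInv L M S k‖ := by
    rw [compressed_defect_eq L M S k G' G hL]
    exact Matrix.l2_opNorm_mul _ _
  have h2 : ‖(G' * JnR L M (starP L M S) k - JnR L M (starP L M S) k * G)
          - JpR L M (starP L M S) k * (G * Nmat L M S k - Nmat L M S k * G)‖
      ≤ ‖G' * JnR L M (starP L M S) k - JnR L M (starP L M S) k * G‖ + ‖G * Nmat L M S k - Nmat L M S k * G‖ := by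
    refine (norm_sub_le _ _).trans (add_le_add le_rfl ?_)
    refine (Matrix.l2_opNorm_mul _ _).trans ?_
    calc ‖JpR L M (starP L M S) k‖ * ‖G * Nmat L M S k - Nmat L M S k * G‖ ≤ 1 * ‖G * Nmat L M S k - Nmat L M S k * G‖ :=
          mul_le_mul_of_nonneg_right hJ (norm_nonneg _)
      _ = _ := one_mul _
  have h0 : 0 ≤ ‖(G' * JnR L M (starP L M S) k - JnR L M (starP L M S) k * G)
          - JpR L M (starP L M S) k * (G * Nmat L M S k - Nmat L M S k * G)‖ := norm_nonneg _
  calc _ ≤ _ := h1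
    _ ≤ ‖(G' * JnR L M (starP L M S) k - JnR L M (starP L M S) k * G)
          - JpR L M (starP L M S) k * (G * Nmat L M S k - Nmat L M S k * G)‖ * 1 := mul_le_mul_of_nonneg_left hNi h0
    _ ≤ _ := by rw [mul_one]; exact h2

end Level

end Summit.QuantumFields.BalabanUV.T4Continuum.DirichletStarRenormReduction

end
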